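import Summits.KontsevichZagierPeriods.KontsevichZagierPeriods.Theorems.SoloBlindCauchyChartB
import Summits.KontsevichZagierPeriods.KontsevichZagierPeriods.Theorems.SoloBlindLine
import Literature.NumberTheory.Transcendental.KZDominatedFamilyRelations
import HarnessLib

/-!
# Cauchy's theorem inside the rules, V: Green's formula, first route — `[D, h] ≡ 0`

`h = -Im g_e'` is `-∂Q/∂x` for `Q = Im g_e` (Cauchy–Riemann).  Integrating first in `x` over the
fibres `(-∞, ½) × {y}` of `D = {x < ½, y > 0}` is ONE Newton–Leibniz move of Kontsevich–Zagier's
calculus, once the fibre is compactified by the rational chart `x = ½ - u/(1-u)`, `u ∈ (0,1)`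
(rule (2)): the primitive is `Q(x(u), y)`, continuous on the closed fibre `[0,1]` with the
value `Q(½, y) = 0` at `u = 0` (`g_e` is real on the axis of symmetry `Re z = ½`) and the limit
`0` at `u = 1` (decay `|g_e| ≤ |x|^{2e}`).  Hence `[D, h_p] ≡ [(0,∞), 0] ≡ 0`:
`of (cauchyRep p) ∈ relations` (`p = 1, 2`).  The second route (first in `y`) is
`SoloBlindCauchyStokesA`; together they are Green's formula for `∬_D h`, i.e. Cauchy's theorem
for `g_e dz` on `∂D`, inside the rules.

References: Kontsevich–Zagier, *Periods* (2001), §1.2 (rules (1)–(3); "in higher dimensions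
one replaces the Newton–Leibniz formula by Stokes's formula").
-/

noncomputable section

namespace Summit.KontsevichZagierPeriods.KontsevichZagierPeriods.Theorems

open Set Complex MeasureTheory Filter
open Literature.ModelTheory.ExponentialFields (IsSemialgebraic isSemialgebraic_setOf_eval_pos
  isSemialgebraic_setOf_eval_nonneg)
open MvPolynomial (aeval X)
open Literature.NumberTheory.Transcendental
open Literature.NumberTheory.Transcendental.KZ

namespace SoloBlind

/-! ## The representations and the moves -/

/-- **`[(0,∞) × [0,1], fB]`**, the band form of `[D, h_p]`. -/
def bandRepB (p : ℕ) (hp : p = 1 ∨ p = 2) : IntegralRep 2 where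
  domain := bandB
  integrand := fB p
  isSemialgebraic_domain := isSemialgebraic_bandB
  isSemialgebraicFunOn_integrand := sa_fB p
  integrableOn := (integrableOn_fB p hp).congr_set_ae
    (ae_eq_set.2 ⟨volume_bandB_diff,
      measure_mono_null (fun _ hw => hw.2 (openBandB_subset_bandB hw.1)) measure_empty⟩)

/-- **`[(0,∞) × (0,1), fB]`**, its restriction to the open band. -/
def openBandRepB (p : ℕ) (hp : p = 1 ∨ p = 2) : IntegralRep 2 :=
  (bandRepB p hp).restrict openBandB isSemialgebraic_openBandB openBandB_subset_bandB

/-- **`[(0,∞), 0]`**, the base of the Newton–Leibniz move. -/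
def zeroLineB : IntegralRep 1 :=
  lineRep (Ioi 0) (fun _ => 0) (isSemialgebraic_line_Ioi isAlgebraic_zero)
    ((isSemialgebraicFunOn_aeval (isSemialgebraic_line_Ioi isAlgebraic_zero)
      (0 : MvPolynomial (Fin 1) ℚ)).congr fun _ _ => by simp)
    integrableOn_zero

/-- The fibre primitive `u ↦ Q_p(½ - m(u), y)` is `O(1-u)` at `u = 1`. -/
theorem abs_im_gPow_le {p : ℕ} (hp : p = 1 ∨ p = 2) {y t : ℝ} (ht : t ∈ Ico (2 / 3 : ℝ) 1) :
    |(gPow ((p : ℝ) / 5 - 1) ((1 / 2 - moeb t : ℝ) + y * I)).im| ≤ 2 * (1 - t) := by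
  have he0 : (p : ℝ) / 5 - 1 ≤ 0 := by rcases hp with rfl | rfl <;> norm_num
  have he2 : (1 / 2 : ℝ) ≤ -((p : ℝ) / 5 - 1) := by rcases hp with rfl | rfl <;> norm_num
  have h1t : 0 < 1 - t := by linarith [ht.2]
  have hx : 1 / 2 - moeb t = (1 - 3 * t) / (2 * (1 - t)) := by
    rw [moeb]; field_simp; ring
  have hxneg : 1 / 2 - moeb t < 0 := by
    rw [hx]; exact div_neg_of_neg_of_pos (by linarith [ht.1]) (by linarith)
  have hb : 0 < 4 * (1 - t) ^ 2 := by positivity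
  have hsq : 1 / (4 * (1 - t) ^ 2) ≤ (1 / 2 - moeb t) ^ 2 := by
    rw [hx, div_pow, div_le_div_iff₀ hb (by positivity)]
    have hk : 0 ≤ ((1 - 3 * t) ^ 2 - 1) * (4 * (1 - t) ^ 2) :=
      mul_nonneg (by nlinarith [ht.1]) hb.le
    nlinarith [hk]
  calc |(gPow ((p : ℝ) / 5 - 1) ((1 / 2 - moeb t : ℝ) + y * I)).im|
      ≤ ‖gPow ((p : ℝ) / 5 - 1) ((1 / 2 - moeb t : ℝ) + y * I)‖ := abs_im_le_norm _
    _ ≤ ((1 / 2 - moeb t) ^ 2) ^ ((p : ℝ) / 5 - 1) := norm_gPow_le_of_re he0 hxneg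
    _ ≤ 2 * (1 - t) := rpow_le_two_mul_one_sub he0 he2 ht.2 (by nlinarith [ht.1, ht.2]) hsq

/-- **Rule (3) in `u`**: `[(0,∞) × [0,1], fB] - [(0,∞), Q(-∞,y) - Q(½,y)] = … - [(0,∞), 0]`
is a relation. -/
theorem bandRepB_sub_zeroLineB (p : ℕ) (hp : p = 1 ∨ p = 2) :
    of (bandRepB p hp) - of zeroLineB ∈ relations := by
  have e0 : ∀ (x : Fin 1 → ℝ) (t : ℝ), (Fin.snoc x t : Fin 2 → ℝ) 0 = x 0 := fun _ _ => rfl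
  have e1 : ∀ (x : Fin 1 → ℝ) (t : ℝ), (Fin.snoc x t : Fin 2 → ℝ) 1 = t := fun _ _ => rfl
  have hch : ∀ (x : Fin 1 → ℝ) (t : ℝ), chartB (Fin.snoc x t) = ![1 / 2 - moeb t, x 0] :=
    fun x t => by funext i; fin_cases i <;> simp [chartB, e0, e1]
  have hdom : ∀ x ∈ zeroLineB.domain, 0 < x 0 := fun x hx => by
    simpa [zeroLineB, mem_line] using hx
  refine newtonLeibnizRel_subset_relations ⟨1, bandRepB p hp, zeroLineB, fun _ => 0, fun _ => 1,
    FB p, sa_FB p,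
    isSemialgebraicFunOn_const_of_isAlgebraic zeroLineB.isSemialgebraic_domain isAlgebraic_zero,
    isSemialgebraicFunOn_const_of_isAlgebraic zeroLineB.isSemialgebraic_domain isAlgebraic_one,
    fun _ _ => zero_le_one, ?_, ?_, ?_, ?_, rfl⟩
  · ext z
    simp only [bandRepB, bandB, mem_setOf_eq, zeroLineB, lineRep_domain, mem_line, mem_Ioi,
      Fin.init, Fin.castSucc_zero, show (Fin.last 1 : Fin 2) = 1 from rfl]
  · intro x hx
    have hy := hdom x hx
    have hG : ∀ t : ℝ, FB p (Fin.snoc x t) =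
        if t < 1 then (gPow ((p : ℝ) / 5 - 1) ((1 / 2 - moeb t : ℝ) + x 0 * I)).im else 0 := by
      intro t
      rw [FB, e1, hch, (Pz_apply p _ _).2.1]
    simp only [hG]
    refine continuousOn_Icc_of_decay (c := 2 / 3) (C := 2) (by norm_num) ?_ (by simp) ?_
    · refine ContinuousOn.congr (f := fun t : ℝ =>
        (gPow ((p : ℝ) / 5 - 1) ((1 / 2 - moeb t : ℝ) + x 0 * I)).im) ?_ fun t ht => if_pos ht.2
      intro t ht
      have h1 : ContinuousAt (fun s : ℝ => 1 / 2 - moeb s) t :=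
        ((hasDerivAt_moeb (ne_of_lt ht.2)).continuousAt).const_sub _
      have h2 := continuousAt_gPow_dx (e := (p : ℝ) / 5 - 1) (x := 1 / 2 - moeb t) (y := x 0)
        (by linarith [moeb_nonneg ht.1 ht.2]) hy
      exact (Complex.continuous_im.continuousAt.comp
        (ContinuousAt.comp (f := fun s : ℝ => 1 / 2 - moeb s) h2 h1)).continuousWithinAt
    · intro t ht
      rw [if_pos ht.2]
      exact abs_im_gPow_le hp ht
  · intro x hx t ht
    have hy := hdom x hx
    have hz : wOf (((1 / 2 - moeb t : ℝ) : ℂ) + x 0 * I) ∈ slitPlane :=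
      wOf_mem_slitPlane (by linarith [moeb_pos ht.1 ht.2]) hy
    have hφ : HasDerivAt (fun s : ℝ => 1 / 2 - moeb s) (-(1 / (1 - t) ^ 2)) t :=
      (hasDerivAt_moeb (ne_of_lt ht.2)).const_sub _
    have hcomp : HasDerivAt
        (fun s : ℝ => (gPow ((p : ℝ) / 5 - 1) (((1 / 2 - moeb s : ℝ) : ℂ) + x 0 * I)).im)
        ((gDer ((p : ℝ) / 5 - 1) (((1 / 2 - moeb t : ℝ) : ℂ) + x 0 * I)).im * (-(1 / (1 - t) ^ 2)))
        t :=
      HasDerivAt.comp t (hasDerivAt_im_gPow hz) hφ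
    have hev : (fun s : ℝ => FB p (Fin.snoc x s)) =ᶠ[nhds t]
        fun s : ℝ => (gPow ((p : ℝ) / 5 - 1) (((1 / 2 - moeb s : ℝ) : ℂ) + x 0 * I)).im := by
      filter_upwards [Iio_mem_nhds ht.2] with s hs
      rw [FB, e1, if_pos (show s < 1 from hs), hch, (Pz_apply p _ _).2.1]
    refine (hcomp.congr_of_eventuallyEq hev).congr_deriv ?_
    show _ = fB p (Fin.snoc x t)
    rw [fB, e1, if_pos ht.2, hch, (Pz_apply p _ _).2.2]
    ring
  · intro x hx
    simp only [zeroLineB, lineRep_integrand]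
    rw [FB, FB, e1, e1, if_neg (lt_irrefl _), if_pos zero_lt_one, hch, moeb_zero, sub_zero,
      (Pz_apply p _ _).2.1, im_gPow_half]
    simp

/-- `[(0,∞) × [0,1], fB] ≡ 0`. -/
theorem of_bandRepB_mem (p : ℕ) (hp : p = 1 ∨ p = 2) : of (bandRepB p hp) ∈ relations := by
  have h2 : of zeroLineB ∈ relations :=
    levelRel_le_relations (of_mem_levelRel_of_eqOn_zero zeroLineB fun x _ => by
      simp [zeroLineB])
  simpa using relations.add_mem (bandRepB_sub_zeroLineB p hp) h2

/-- `[(0,∞) × (0,1), fB] ≡ 0` (null modification). -/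
theorem of_openBandRepB_mem (p : ℕ) (hp : p = 1 ∨ p = 2) :
    of (openBandRepB p hp) ∈ relations := by
  have h1 : of (bandRepB p hp) - of (openBandRepB p hp) ∈ relations :=
    (bandRepB p hp).of_sub_of_restrict_mem_relations isSemialgebraic_openBandB
      openBandB_subset_bandB volume_bandB_diff
  simpa using relations.sub_mem (of_bandRepB_mem p hp) h1

/-- **Rule (2) along `Φ_B`**: `[(0,∞) × (0,1), fB] ≡ [D, h_p]`. -/
theorem openBandRepB_equivalent (p : ℕ) (hp : p = 1 ∨ p = 2) :
    Equivalent (openBandRepB p hp) (cauchyRep p hp) :=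
  equivalent_of_chart (f := fB p) (g := Hz p) (J := fun w => 1 / (1 - w 1) ^ 2)
    (isSemialgebraicMapOn_chartB isSemialgebraic_openBandB fun w hw => ne_of_lt hw.2.2)
    (fun w hw => hasFDerivAt_chartB (ne_of_lt hw.2.2)) (injOn_chartB.mono fun w hw => hw.2.2)
    image_chartB (fun w _ => abs_det_chartBDeriv w)
    (fun w hw => by simp [fB, hw.2.2, div_eq_mul_inv]) rfl (fun _ _ => rfl) rfl (fun _ _ => rfl)

/-- **Green's formula inside the rules (route B): `[D, h_p] ≡ 0`** for `p = 1, 2`. -/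
theorem of_cauchyRep_mem_relations (p : ℕ) (hp : p = 1 ∨ p = 2) :
    of (cauchyRep p hp) ∈ relations := by
  simpa using relations.sub_mem (of_openBandRepB_mem p hp) (openBandRepB_equivalent p hp)

end SoloBlind

end Summit.KontsevichZagierPeriods.KontsevichZagierPeriods.Theorems
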